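import Literature.MathematicalPhysics.QuantumLattice.GrassmannBerezinLaplacianBridge
import HarnessLib

/-!
# A Grassmann integral is determined on the pair monomials by its characteristic function `J ↦ ∫ e^{−⟨ψ̄,Jψ⟩}` —
# the converse half of Dimock–Yuan, App. B LEMMA 23 ((476) ⟹ (477)), finite form

Topic `Literature/MathematicalPhysics/QuantumLattice`; continues `GrassmannBerezinLaplacianBridge.lean` §5 (the direct half
of LEMMA 23 in finite form: `∫ e^{−ψ̄Jψ} dμ_G = det(1 + JG)`, `gaussExpect_twoSpeciesCov_grassmannExp_neg_quadratic`).

statement-level skeleton of published theorems with citation tags; proofs where landed; nothing here is a claim about the Yang–Mills mass gap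

**The printed argument.**  J. Dimock, C. Yuan, *Structural stability of the RG flow in the Gross–Neveu model*, arXiv:2303.07916
[DimockYuan2024GNFlow], App. B LEMMA 23 («an integral … is Gaussian with covariance `G` if and only if the characteristic
function satisfies `∫ e^{⟨ψ,Jψ̄⟩}dμ = det(I + JᵀG)` (472) for all smooth functions `J`»), proof of the converse, p.71 L40 –
p.72 L1 of the held text layer `paper:arxiv-2303.07916`: *"For the converse suppose that `∫ e^{⟨ψ,Jψ̄⟩}dμ = det(I + JᵀG)`.
We compare the terms n-th order in `J` and find `∫[∫ψ(x₁)ψ̄(y₁)⋯ψ(x_n)ψ̄(y_n)dμ] ∏ᵢJ(xᵢ,yᵢ)dxdy =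
∫ det{G(xᵢ,yⱼ)} ∏ᵢJ(xᵢ,yᵢ)dxdy` (476)  Both sides of this equation are homogeneous functions of `J` of degree `n` … by the
polarization formula … we can replace `∏J(xᵢ,yᵢ)` by `∏Jᵢ(xᵢ,yᵢ)` … By the kernel theorem the associated kernels are
equal … Thus `∫ ψ(x₁)ψ̄(y₁)⋯ψ(x_n)ψ̄(y_n) dμ = det{G(xᵢ,yⱼ)}` (477) which is our result."*  Also J. Dimock, *Correlation
functions for the Gross–Neveu model* [Dimock2025GNCorrelations] §2.2 (56): *"if `∫·dμ` is an integral on `𝒢_h` satisfying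
`∫ e^{−⟨ψ̄,Jψ⟩}dμ(ψ) = det(I + JG)` (56) then it is the Gaussian integral with covariance `G`. Thus this integral is in a
certain sense a characteristic function of the Gaussian integral."*

**What is formalised (finite index set `ι`; `R` any commutative `ℚ`-algebra; kernel-checked, no `sorry`, no named facts).**
In finite dimensions the comparison of `n`-th order terms is exact combinatorics: with the `0∕1` matrix `1_T` of a set `T` of
pairs, `e^{−⟨ψ̄,1_Tψ⟩} = ∏_{(a,b)∈T}(1 − ψ̄_aψ_b) = Σ_{U⊆T} ∏_{(a,b)∈U}(−ψ̄_aψ_b)` (`grassmannExp_neg_quadratic_indicator`, from the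
tree's `exp_sum_eq_sum_noncommProd`), so by induction on `U` two linear functionals with the same values on all
`e^{−⟨ψ̄,1_Tψ⟩}` agree on every pair product `∏_{(a,b)∈U} ψ̄_aψ_b` (**`eq_on_pairProd_of_charFun_eq`**) — the printed
polarization ∕ kernel-theorem step replaced by Möbius inversion over subsets.  Consequently (**`apply_prod_psiBar_psi_eq_of_charFun`**,
(476) ⟹ (477)): an `R`-linear functional `μ` on `Λ(ι ⊕ₗ ι)` with `μ(e^{−⟨ψ̄,Jψ⟩}) = det(1 + JG)` for all `J` (even: for all
`0∕1` matrices `J`), `A G = −1`, satisfies `μ(ψ̄_{x₁}ψ_{y₁}⋯ψ̄_{x_n}ψ_{y_n}) = ∫ ψ̄_{x₁}ψ_{y₁}⋯ψ̄_{x_n}ψ_{y_n} dμ_G` for all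
tuples `x, y` — the finite-dimensional (477), the right side being the determinant of the two-point functions by (309) ∕
`berezin_grassmannExp_quadratic_mul_prod`.  Scope: pair monomials only (the charge-neutral sector they span); nothing about
the torus, trace-class operators or Fredholm determinants.
-/

noncomputable section

namespace Literature.MathematicalPhysics.QuantumLattice

open GrassmannAlgebra

section PairProducts

variable (R : Type*) [CommRing R] {ι : Type*} [LinearOrder ι]

/-- The (central, square-zero) pair `−ψ̄_aψ_b` attached to a pair of sites. [cite: DimockYuan2024GNFlow, App. B Lemma 23 proof
(476) p.71 L40–49] -/
def negPair (p : ι × ι) : GrassmannAlgebra R (ι ⊕ₗ ι) := -(psiBar R p.1 * psi R p.2)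

/-- `−ψ̄_aψ_b` is central. [cite: DimockYuan2024GNFlow, App. B Lemma 23 proof (476) p.71 L40–49] -/
theorem commute_negPair (p : ι × ι) (z : GrassmannAlgebra R (ι ⊕ₗ ι)) : Commute (negPair R p) z :=
  (commute_psiBar_mul_psi R p.1 p.2 z).neg_left

/-- `(−ψ̄_aψ_b)² = 0`. [cite: DimockYuan2024GNFlow, App. B Lemma 23 proof (476) p.71 L40–49] -/
theorem negPair_mul_self (p : ι × ι) : negPair R p * negPair R p = 0 := by
  rw [negPair, neg_mul_neg, psiBar_mul_psi_mul_psiBar_mul_psi_self]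

/-- **The pair products** `∏_{(a,b)∈U} (−ψ̄_aψ_b)` over a finite set of pairs (order-independent: the factors are central) —
the finite-dimensional carriers of the «terms n-th order in `J`» of (476). [cite: DimockYuan2024GNFlow, App. B Lemma 23 proof
(476) p.71 L40–49] -/
def negPairProd (U : Finset (ι × ι)) : GrassmannAlgebra R (ι ⊕ₗ ι) :=
  U.noncommProd (negPair R) fun p _ q _ _ => commute_negPair R p (negPair R q)

/-- The `0∕1` matrix of a set of pairs, `(1_T)_{ab} = [(a,b) ∈ T]`. [cite: DimockYuan2024GNFlow, App. B Lemma 23 proof (476)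
p.71 L40–49] -/
def indicatorOfPairs (T : Finset (ι × ι)) : Matrix ι ι R := Matrix.of fun a b => if (a, b) ∈ T then 1 else 0

variable [Fintype ι]

/-- `⟨ψ̄, 1_T ψ⟩ = Σ_{(a,b)∈T} ψ̄_aψ_b`, i.e. `−quadratic R (1_T) = Σ_{p∈T} (−ψ̄_{p.1}ψ_{p.2})`.
[cite: DimockYuan2024GNFlow, App. B Lemma 23 proof (476) p.71 L40–49] -/
theorem neg_quadratic_indicatorOfPairs (T : Finset (ι × ι)) :
    -quadratic R (indicatorOfPairs R T) = ∑ p ∈ T, negPair R p := by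
  classical
  rw [quadratic, ← Finset.sum_neg_distrib]
  simp_rw [← Finset.sum_neg_distrib]
  rw [← Finset.sum_product' Finset.univ Finset.univ (fun a b => -(indicatorOfPairs R T a b • (psiBar R a * psi R b))),
    Finset.univ_product_univ, ← Finset.sum_subset (Finset.subset_univ T)]
  · refine Finset.sum_congr rfl fun p hp => ?_
    rw [indicatorOfPairs, Matrix.of_apply, if_pos (by simpa using hp), one_smul, negPair]
  · intro p _ hp
    rw [indicatorOfPairs, Matrix.of_apply, if_neg (by simpa using hp), zero_smul, neg_zero]

variable [Algebra ℚ R]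

/-- **`e^{−⟨ψ̄,1_Tψ⟩} = Σ_{U ⊆ T} ∏_{(a,b)∈U} (−ψ̄_aψ_b)`** — the exact finite expansion of the characteristic exponential at a
`0∕1` matrix (each `−ψ̄_aψ_b` is central with square zero: `exp_sum_eq_sum_noncommProd`).
[cite: DimockYuan2024GNFlow, App. B Lemma 23 proof (476) p.71 L40–49] -/
theorem grassmannExp_neg_quadratic_indicatorOfPairs (T : Finset (ι × ι)) :
    grassmannExp (-quadratic R (indicatorOfPairs R T)) = ∑ U ∈ T.powerset, negPairProd R U := by
  classical
  rw [neg_quadratic_indicatorOfPairs, grassmannExp,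
    exp_sum_eq_sum_noncommProd (negPair R) (commute_negPair R) (negPair_mul_self R) T]
  rfl

/-- **Two linear functionals with the same characteristic function on the `0∕1` matrices agree on every pair product**
(the finite-dimensional «compare the terms n-th order in `J`», by induction on the set of pairs: the top term of the
expansion of `e^{−⟨ψ̄,1_Uψ⟩}` is `∏_{(a,b)∈U}(−ψ̄_aψ_b)`, all others are pair products over proper subsets).
[cite: DimockYuan2024GNFlow, App. B Lemma 23 proof (476)–(477) p.71 L40 – p.72 L1] -/
theorem eq_on_negPairProd_of_charFun_eq {M : Type*} [AddCommGroup M] [Module R M] (μ ν : GrassmannAlgebra R (ι ⊕ₗ ι) →ₗ[R] M)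
    (h : ∀ T : Finset (ι × ι), μ (grassmannExp (-quadratic R (indicatorOfPairs R T))) =
      ν (grassmannExp (-quadratic R (indicatorOfPairs R T))))
    (U : Finset (ι × ι)) : μ (negPairProd R U) = ν (negPairProd R U) := by
  classical
  induction U using Finset.strongInduction with
  | H U ih =>
    have hU := h U
    rw [grassmannExp_neg_quadratic_indicatorOfPairs, map_sum, map_sum,
      ← Finset.add_sum_erase _ _ (Finset.mem_powerset_self U), ← Finset.add_sum_erase _ _ (Finset.mem_powerset_self U)] at hU
    have hrest : ∑ V ∈ U.powerset.erase U, μ (negPairProd R V) = ∑ V ∈ U.powerset.erase U, ν (negPairProd R V) := by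
      refine Finset.sum_congr rfl fun V hV => ih V ?_
      rw [Finset.mem_erase, Finset.mem_powerset] at hV
      exact lt_of_le_of_ne hV.2 hV.1
    rw [hrest] at hU
    exact add_right_cancel hU

omit [Fintype ι] [Algebra ℚ R] in
/-- The unsigned pair product: `∏_{(a,b)∈U} ψ̄_aψ_b = (−1)^{|U|} ∏_{(a,b)∈U} (−ψ̄_aψ_b)`.
[cite: DimockYuan2024GNFlow, App. B Lemma 23 proof (477) p.71 L78 – p.72 L1] -/
theorem noncommProd_psiBar_mul_psi_eq (U : Finset (ι × ι)) :
    U.noncommProd (fun p => psiBar R p.1 * psi R p.2) (fun p _ _ _ _ => commute_psiBar_mul_psi R p.1 p.2 _) =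
      (-1 : R) ^ U.card • negPairProd R U := by
  classical
  induction U using Finset.induction_on with
  | empty => simp [negPairProd]
  | insert p U hp ih =>
    rw [Finset.noncommProd_insert_of_notMem _ _ _ _ hp, negPairProd, Finset.noncommProd_insert_of_notMem _ _ _ _ hp,
      ← negPairProd, ih, Finset.card_insert_of_notMem hp, pow_succ, negPair, mul_smul_comm, neg_mul, mul_neg_one,
      neg_smul, smul_neg, neg_neg]

/-- **… hence on the unsigned pair products** `∏_{(a,b)∈U} ψ̄_aψ_b`. [cite: DimockYuan2024GNFlow, App. B Lemma 23 proof
(476)–(477) p.71 L40 – p.72 L1] -/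
theorem eq_on_pairProd_of_charFun_eq {M : Type*} [AddCommGroup M] [Module R M] (μ ν : GrassmannAlgebra R (ι ⊕ₗ ι) →ₗ[R] M)
    (h : ∀ T : Finset (ι × ι), μ (grassmannExp (-quadratic R (indicatorOfPairs R T))) =
      ν (grassmannExp (-quadratic R (indicatorOfPairs R T))))
    (U : Finset (ι × ι)) :
    μ (U.noncommProd (fun p => psiBar R p.1 * psi R p.2) (fun p _ _ _ _ => commute_psiBar_mul_psi R p.1 p.2 _)) =
      ν (U.noncommProd (fun p => psiBar R p.1 * psi R p.2) (fun p _ _ _ _ => commute_psiBar_mul_psi R p.1 p.2 _)) := by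
  rw [noncommProd_psiBar_mul_psi_eq, map_smul, map_smul, eq_on_negPairProd_of_charFun_eq R μ ν h U]

/-- **… and on the ordered products `ψ̄_{x₁}ψ_{y₁}⋯ψ̄_{x_n}ψ_{y_n}`** for arbitrary tuples (a repeated `ψ̄` kills the
product on both sides; distinct pairs reduce to the set product). [cite: DimockYuan2024GNFlow, App. B Lemma 23 proof (477)
p.71 L78 – p.72 L1] -/
theorem eq_on_prod_psiBar_psi_of_charFun_eq {M : Type*} [AddCommGroup M] [Module R M]
    (μ ν : GrassmannAlgebra R (ι ⊕ₗ ι) →ₗ[R] M)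
    (h : ∀ T : Finset (ι × ι), μ (grassmannExp (-quadratic R (indicatorOfPairs R T))) =
      ν (grassmannExp (-quadratic R (indicatorOfPairs R T))))
    {n : ℕ} (x y : Fin n → ι) :
    μ ((List.ofFn fun a => psiBar R (x a) * psi R (y a)).prod) = ν ((List.ofFn fun a => psiBar R (x a) * psi R (y a)).prod) := by
  classical
  by_cases hx : Function.Injective x
  · -- distinct pairs: the ordered product is the set product over the image
    have hp : Function.Injective (fun a => (x a, y a)) := fun a b hab => hx (congrArg Prod.fst hab)
    have hprod : (List.ofFn fun a => psiBar R (x a) * psi R (y a)).prod =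
        (List.ofFn fun a => (x a, y a)).toFinset.noncommProd (fun p => psiBar R p.1 * psi R p.2)
          (fun p _ _ _ _ => commute_psiBar_mul_psi R p.1 p.2 _) := by
      rw [Finset.noncommProd_toFinset _ _ _ (List.nodup_ofFn.mpr hp), List.map_ofFn]
      rfl
    rw [hprod]
    exact eq_on_pairProd_of_charFun_eq R μ ν h _
  · -- a repeated `ψ̄`: both sides vanish
    obtain ⟨a, b, hab, hne⟩ : ∃ a b, x a = x b ∧ a ≠ b := by
      simpa only [Function.Injective, not_forall, Classical.not_imp, exists_prop] using hx
    rw [prod_ofFn_psiBar_mul_psi_eq_zero R x y hne hab, map_zero, map_zero]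

end PairProducts

/-! ## (476) ⟹ (477): an integral with characteristic function `det(1 + JG)` is `dμ_G` on the pair monomials -/

section Converse

variable (R : Type*) [CommRing R] [Algebra ℚ R] {ι : Type*} [LinearOrder ι] [Fintype ι]
variable {A G : Matrix ι ι R} (hAG : A * G = -1)
include hAG

/-- **Dimock–Yuan App. B LEMMA 23, the converse ((476) ⟹ (477)), in finite form**: an `R`-linear functional `μ` on the
two-species Grassmann algebra whose characteristic function is that of `dμ_G` on the `0∕1` matrices,
`μ(e^{−⟨ψ̄,1_Tψ⟩}) = det(1 + 1_T G)` for every set of pairs `T` (in particular if `μ(e^{−⟨ψ̄,Jψ⟩}) = det(1 + JG)` for ALL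
`J`, the printed hypothesis), agrees with `dμ_G` (`G` invertible, `A G = −1`) on every ordered product
`ψ̄_{x₁}ψ_{y₁}⋯ψ̄_{x_n}ψ_{y_n}`: *"Thus `∫ ψ(x₁)ψ̄(y₁)⋯ψ(x_n)ψ̄(y_n) dμ = det{G(xᵢ,yⱼ)}` (477)"* (the right side here as
`∫ ⋯ dμ_G`, whose value is the determinant of two-point functions by (309)).  [cite: DimockYuan2024GNFlow, App. B Lemma 23
(472) p.70 L68–73; proof of the converse (476)–(477) p.71 L40 – p.72 L1; Dimock2025GNCorrelations, §2.2 (56) p.11 L15–18] -/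
theorem apply_prod_psiBar_psi_eq_of_charFun (μ : GrassmannAlgebra R (ι ⊕ₗ ι) →ₗ[R] R)
    (hchar : ∀ T : Finset (ι × ι),
      μ (grassmannExp (-quadratic R (indicatorOfPairs R T))) = (1 + indicatorOfPairs R T * G).det)
    {n : ℕ} (x y : Fin n → ι) :
    μ ((List.ofFn fun a => psiBar R (x a) * psi R (y a)).prod) =
      gaussExpect R (twoSpeciesCov R G) ((List.ofFn fun a => psiBar R (x a) * psi R (y a)).prod) :=
  eq_on_prod_psiBar_psi_of_charFun_eq R μ (gaussExpect R (twoSpeciesCov R G))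
    (fun T => by rw [hchar T, gaussExpect_twoSpeciesCov_grassmannExp_neg_quadratic R hAG]) x y

/-- The same with the printed hypothesis «for all `J`». [cite: DimockYuan2024GNFlow, App. B Lemma 23 (472)–(477) p.70–72] -/
theorem apply_prod_psiBar_psi_eq_of_charFun_all (μ : GrassmannAlgebra R (ι ⊕ₗ ι) →ₗ[R] R)
    (hchar : ∀ J : Matrix ι ι R, μ (grassmannExp (-quadratic R J)) = (1 + J * G).det) {n : ℕ} (x y : Fin n → ι) :
    μ ((List.ofFn fun a => psiBar R (x a) * psi R (y a)).prod) =
      gaussExpect R (twoSpeciesCov R G) ((List.ofFn fun a => psiBar R (x a) * psi R (y a)).prod) :=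
  apply_prod_psiBar_psi_eq_of_charFun R hAG μ (fun _ => hchar _) x y

/-- **(477) with the determinant written out**: under the same hypothesis, for `A` with `A G = −1`,
`μ(ψ̄_{x₁}ψ_{y₁}⋯ψ̄_{x_n}ψ_{y_n}) = det{(A⁻¹)_{y_a x_b}} = det{−G_{y_a x_b}}` — via the Berezin-form moments
`berezin_grassmannExp_quadratic_mul_prod` (Mastropietro 2008 (2.12)) transported by the bridge. [cite: DimockYuan2024GNFlow,
App. B Lemma 23 proof (477) p.71 L78 – p.72 L1; Mastropietro2008, Ch. 2 (2.12)] -/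
theorem apply_prod_psiBar_psi_eq_det_of_charFun (μ : GrassmannAlgebra R (ι ⊕ₗ ι) →ₗ[R] R)
    (hchar : ∀ J : Matrix ι ι R, μ (grassmannExp (-quadratic R J)) = (1 + J * G).det) {n : ℕ} (x y : Fin n → ι) :
    μ ((List.ofFn fun a => psiBar R (x a) * psi R (y a)).prod) = (Matrix.of fun a b => -G (y a) (x b)).det := by
  have hAG' : A * (-G) = 1 := by rw [Matrix.mul_neg, hAG, neg_neg]
  have hA : IsUnit A.det := Matrix.isUnit_det_of_right_inverse hAG'
  have hinv : A⁻¹ = -G := Matrix.inv_eq_right_inv hAG'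
  have hunit : IsUnit ((-1 : R) ^ (Fintype.card ι * (Fintype.card ι - 1) / 2) * A.det) :=
    ((isUnit_one (M := R)).neg.pow _).mul hA
  rw [apply_prod_psiBar_psi_eq_of_charFun_all R hAG μ hchar x y]
  have h := berezin_grassmannExp_quadratic_mul_prod R A hA x y
  rw [berezin_grassmannExp_quadratic_mul_eq_det_mul R hAG, hinv] at h
  exact hunit.mul_right_inj.mp h

end Converse

end Literature.MathematicalPhysics.QuantumLattice

end
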